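import Summits.Ventures.HodgeRepro2.T5SU11Fibration

/-!
# The Haar measure of `SU(1,1)` through the disc, II: `Φ_* (poincare ⊗ μ_K)` is a Haar measure

With the section `s`, the rotation subgroup `rot : Circle →* SU11` and the cocycle identity of
`T5SU11Fibration`, the map `Φ (z, u) = s(z) · rot u` carries the product of the Poincaré measure
of the disc and a Haar measure `μC` of the circle to a measure `ν` on `SU(1,1)` which is
LEFT-INVARIANT (`nu_apply` + the cocycle + the invariance of `μC` + `map_mobius_poincare`) and
finite on compact sets (`Φ⁻¹ C ⊆ (orbit '' C ∪ 𝔻ᶜ) × Circle`); by Mathlib's uniqueness of Haar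
measures on the second countable `SU(1,1)`, `ν = c · μ` for every Haar measure `μ`, with `c > 0`,
and for every `μ`-integrable `f`:
`c • ∫_G f dμ = ∫_𝔻 (1 - |z|²)⁻² • (∫_K f (s(z) k) dk) dA(z)`.
This is the support map's «Rühl's measure IS a Haar measure on `SU(1,1)`» (N4.3 / P2′) up to the
normalisation constant `c`.

Blind lane: Mathlib + own prefix only; no sorry; axioms ⊆ {propext, Classical.choice, Quot.sound}.
-/

namespace Summit.Ventures.HodgeRepro2.T5SU11FibrationHaar

open MeasureTheory MeasureTheory.Measure Metric Topology T5PoincareDensity T5PoincareInvariance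
  T5PoincareMeasure T5SU11Unimodular T5UnitaryBound T5SU11Fibration
open scoped ENNReal NNReal

section measure

variable [MeasurableSpace Circle] [BorelSpace Circle]

/-- `Φ` is measurable. -/
lemma measurable_fib : Measurable fib :=
  (measurable_sec.comp measurable_fst).mul (continuous_rot.measurable.comp measurable_snd)

variable (μC : Measure Circle) [IsHaarMeasure μC]

/-- **The candidate Haar measure** `ν := Φ_* (poincare ⊗ μC)` on `SU(1,1)`. -/
noncomputable def nu : Measure SU11 := map fib (poincare.prod μC)

/-- `ν S = ∫_𝔻 dens z · ∫_K 1_S (s(z) k) dk dA(z)`. -/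
theorem nu_apply {S : Set SU11} (hS : MeasurableSet S) :
    nu μC S = ∫⁻ z in ball 0 1, ENNReal.ofReal (dens z) *
      ∫⁻ u, S.indicator 1 (sec z * rot u) ∂μC := by
  have hpre : MeasurableSet (fib ⁻¹' S) := measurable_fib hS
  have hind : Measurable fun p : ℂ × Circle => S.indicator (1 : SU11 → ℝ≥0∞) (fib p) :=
    (measurable_const.indicator hS).comp measurable_fib
  rw [nu, map_apply measurable_fib hS, ← lintegral_indicator_one hpre]
  have e : (fun p : ℂ × Circle => (fib ⁻¹' S).indicator (1 : ℂ × Circle → ℝ≥0∞) p) =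
      fun p => S.indicator (1 : SU11 → ℝ≥0∞) (fib p) := by
    ext p
    by_cases hp : fib p ∈ S <;> simp [hp]
  rw [e, lintegral_prod _ hind.aemeasurable]
  unfold poincare
  rw [lintegral_withDensity_eq_lintegral_mul _ measurable_dens.ennreal_ofReal
    (Measurable.lintegral_prod_right' hind)]
  rfl

/-- **`ν` is left-invariant.** -/
theorem isMulLeftInvariant_nu : IsMulLeftInvariant (nu μC) := by
  refine ⟨fun g => ?_⟩
  ext S hS
  rw [map_apply (measurable_const_mul g) hS, nu_apply μC (measurable_const_mul g hS), nu_apply μC hS]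
  set a := ((g : Matrix.SpecialLinearGroup (Fin 2) ℂ) : Matrix (Fin 2) (Fin 2) ℂ) 0 0 with ha
  set b := ((g : Matrix.SpecialLinearGroup (Fin 2) ℂ) : Matrix (Fin 2) (Fin 2) ℂ) 0 1 with hb
  have hab : Complex.normSq a - Complex.normSq b = 1 := normSq_sub_normSq g
  have hmat : ((g : Matrix.SpecialLinearGroup (Fin 2) ℂ) : Matrix (Fin 2) (Fin 2) ℂ) = su11 a b :=
    coe_eq_su11 g
  -- the inner integral as a function of the base point
  set H : ℂ → ℝ≥0∞ := fun w => ∫⁻ u, S.indicator 1 (sec w * rot u) ∂μC with hH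
  have key : ∀ z ∈ ball 0 1,
      ENNReal.ofReal (dens z) * ∫⁻ u, ((fun x => g * x) ⁻¹' S).indicator 1 (sec z * rot u) ∂μC =
        ENNReal.ofReal (dens z) * H (mobius (su11 a b) z) := by
    intro z hz
    obtain ⟨u₀, hu₀⟩ := exists_cocycle g hz
    rw [hmat] at hu₀
    congr 1
    have e : ∀ u : Circle, ((fun x => g * x) ⁻¹' S).indicator (1 : SU11 → ℝ≥0∞) (sec z * rot u) =
        S.indicator 1 (sec (mobius (su11 a b) z) * rot (u₀ * u)) := by
      intro u
      have : g * (sec z * rot u) = sec (mobius (su11 a b) z) * rot (u₀ * u) := by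
        rw [← mul_assoc, hu₀, map_mul, mul_assoc]
      by_cases hmem : sec (mobius (su11 a b) z) * rot (u₀ * u) ∈ S
      · rw [Set.indicator_of_mem hmem, Set.indicator_of_mem
          (show sec z * rot u ∈ (fun x => g * x) ⁻¹' S by rw [Set.mem_preimage, this]; exact hmem)]
        rfl
      · rw [Set.indicator_of_notMem hmem, Set.indicator_of_notMem
          (show sec z * rot u ∉ (fun x => g * x) ⁻¹' S by rw [Set.mem_preimage, this]; exact hmem)]
    simp_rw [e]
    exact lintegral_mul_left_eq_self (fun u => S.indicator 1 (sec (mobius (su11 a b) z) * rot u)) u₀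
  rw [setLIntegral_congr_fun measurableSet_ball key]
  exact lintegral_ball_comp_mobius a b hab H

/-- **`ν` is finite on compact sets**: `Φ⁻¹ C ⊆ (orbit '' C ∪ 𝔻ᶜ) × Circle`. -/
theorem isFiniteMeasureOnCompacts_nu : IsFiniteMeasureOnCompacts (nu μC) := by
  refine ⟨fun C hC => ?_⟩
  set K : Set ℂ := orbit '' C with hK
  have hKc : IsCompact K := hC.image continuous_orbit
  have hKb : K ⊆ ball 0 1 := by
    rintro z ⟨g, _, rfl⟩
    exact orbit_mem_ball g
  have hsub : fib ⁻¹' C ⊆ (K ∪ (ball 0 1)ᶜ) ×ˢ Set.univ := by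
    rintro ⟨z, u⟩ hp
    refine ⟨?_, Set.mem_univ _⟩
    by_cases hz : z ∈ ball 0 1
    · left
      exact ⟨fib (z, u), hp, orbit_fib hz u⟩
    · right
      exact hz
  rw [nu, map_apply measurable_fib hC.measurableSet]
  calc (poincare.prod μC) (fib ⁻¹' C)
      ≤ (poincare.prod μC) ((K ∪ (ball 0 1)ᶜ) ×ˢ Set.univ) := measure_mono hsub
    _ = poincare (K ∪ (ball 0 1)ᶜ) * μC Set.univ := Measure.prod_prod _ _
    _ ≤ (poincare K + poincare (ball 0 1)ᶜ) * μC Set.univ := by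
        gcongr
        exact measure_union_le _ _
    _ < ∞ := by
        rw [poincare_compl_ball, add_zero]
        exact ENNReal.mul_lt_top (poincare_lt_top_of_isCompact hKc hKb) (measure_lt_top _ _)

/-- `ν` is left-invariant (instance form). -/
instance instIsMulLeftInvariantNu : IsMulLeftInvariant (nu μC) := isMulLeftInvariant_nu μC

/-- `ν` is finite on compact sets (instance form). -/
instance instIsFiniteMeasureOnCompactsNu : IsFiniteMeasureOnCompacts (nu μC) :=
  isFiniteMeasureOnCompacts_nu μC

/-- **THE FIBRATION THEOREM**: `ν = Φ_* (poincare ⊗ μC)` is a positive multiple of every Haar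
measure `μ` on `SU(1,1)` (uniqueness of left-invariant measures on the second countable
`SU(1,1)`). -/
theorem nu_eq_smul (μ : Measure SU11) [IsHaarMeasure μ] :
    nu μC = haarScalarFactor (nu μC) μ • μ :=
  isMulLeftInvariant_eq_smul (nu μC) μ

/-- `ν (univ) > 0`. -/
lemma nu_univ_pos : 0 < nu μC Set.univ := by
  rw [nu, map_apply measurable_fib MeasurableSet.univ, Set.preimage_univ, ← Set.univ_prod_univ,
    Measure.prod_prod]
  apply ENNReal.mul_pos
  · -- `poincare univ ≥ volume (ball 0 1) > 0`
    have h1 : volume (ball (0 : ℂ) 1) ≤ poincare Set.univ := by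
      unfold poincare
      rw [withDensity_apply _ MeasurableSet.univ, Measure.restrict_univ]
      calc volume (ball (0 : ℂ) 1) = ∫⁻ _ in ball (0 : ℂ) 1, (1 : ℝ≥0∞) := (setLIntegral_one _).symm
        _ ≤ ∫⁻ z in ball (0 : ℂ) 1, ENNReal.ofReal (dens z) := by
          apply setLIntegral_mono measurable_dens.ennreal_ofReal
          intro z hz
          rw [mem_ball_iff_normSq] at hz
          have h0 : 0 ≤ Complex.normSq z := Complex.normSq_nonneg z
          have hle : (1 - Complex.normSq z) ^ 2 ≤ 1 :=
            pow_le_one₀ (by linarith) (by linarith)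
          have hpos : 0 < (1 - Complex.normSq z) ^ 2 := by positivity
          rw [← ENNReal.ofReal_one]
          apply ENNReal.ofReal_le_ofReal
          unfold dens
          rw [le_div_iff₀ hpos, one_mul]
          exact hle
    exact (Metric.measure_ball_pos volume (0 : ℂ) one_pos).trans_le h1 |>.ne'
  · exact (isOpen_univ.measure_pos μC Set.univ_nonempty).ne'

/-- The scalar of the fibration theorem is positive. -/
theorem haarScalarFactor_nu_pos (μ : Measure SU11) [IsHaarMeasure μ] :
    0 < haarScalarFactor (nu μC) μ := by
  rcases eq_or_lt_of_le (zero_le : (0 : ℝ≥0) ≤ haarScalarFactor (nu μC) μ) with h | h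
  · exfalso
    have := nu_eq_smul μC μ
    rw [← h, zero_smul] at this
    have h0 := nu_univ_pos μC
    rw [this] at h0
    simp at h0
  · exact h

/-- `ν` is a Haar measure (a positive multiple of one). -/
instance instIsHaarMeasureNu : IsHaarMeasure (nu μC) := by
  rw [nu_eq_smul μC haar]
  exact IsHaarMeasure.smul _ (ENNReal.coe_ne_zero.mpr (haarScalarFactor_nu_pos μC haar).ne')
    ENNReal.coe_ne_top

/-- **The integral formula** («Rühl's measure»): for every Haar measure `μ` on `SU(1,1)` and every
`μ`-integrable `f`, with `c = haarScalarFactor ν μ > 0`,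
`c • ∫ f dμ = ∫_𝔻 (1 - |z|²)⁻² • (∫_K f (s(z) k) dk) dA(z)`. -/
theorem integral_eq (μ : Measure SU11) [IsHaarMeasure μ] {E : Type*} [NormedAddCommGroup E]
    [NormedSpace ℝ E] [CompleteSpace E] (f : SU11 → E) (hf : Integrable f μ) :
    (haarScalarFactor (nu μC) μ : ℝ) • ∫ g, f g ∂μ =
      ∫ z in ball 0 1, dens z • ∫ u, f (sec z * rot u) ∂μC := by
  set c := haarScalarFactor (nu μC) μ with hc
  have hnu : nu μC = c • μ := nu_eq_smul μC μ
  have hint : Integrable f (nu μC) := by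
    rw [hnu]
    exact hf.smul_measure ENNReal.coe_ne_top
  have h1 : ∫ g, f g ∂(nu μC) = (c : ℝ) • ∫ g, f g ∂μ := by
    rw [hnu, integral_smul_nnreal_measure, NNReal.smul_def]
  have hint' : Integrable (f ∘ fib) (poincare.prod μC) :=
    (integrable_map_measure hint.aestronglyMeasurable measurable_fib.aemeasurable).mp hint
  have h2 : ∫ g, f g ∂(nu μC) = ∫ p, f (fib p) ∂(poincare.prod μC) :=
    integral_map measurable_fib.aemeasurable hint.aestronglyMeasurable
  have h3 : ∫ p, f (fib p) ∂(poincare.prod μC) = ∫ z, ∫ u, f (fib (z, u)) ∂μC ∂poincare :=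
    integral_prod _ hint'
  have h4 : ∫ z, ∫ u, f (fib (z, u)) ∂μC ∂poincare =
      ∫ z in ball 0 1, dens z • ∫ u, f (sec z * rot u) ∂μC := by
    have hd : Measurable fun z : ℂ => Real.toNNReal (dens z) := measurable_dens.real_toNNReal
    have e : poincare = (volume.restrict (ball 0 1)).withDensity
        fun z => ((Real.toNNReal (dens z) : ℝ≥0) : ℝ≥0∞) := rfl
    rw [e, integral_withDensity_eq_integral_smul hd]
    congr 1
    ext z
    rw [NNReal.smul_def, Real.coe_toNNReal _ (dens_nonneg z)]
    rfl
  rw [← h1, h2, h3, h4]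

end measure

end Summit.Ventures.HodgeRepro2.T5SU11FibrationHaar
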